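import Summits.QuantumFields.YangMills.Theorems.BalabanUVNodesPortS1LZdetTwinObjects

/-!
# NODE O port PT-A — THE CENTRED INTEGER LIFT OF A LEVEL-`k` TORUS SITE ∕ BOND THROUGH ITS `Mc`-CUBE (objects of the cover bridge of `stub_LZdetTwin`, 27930, line `pta_residueW`)

Cell `ym-nodeO-ideate`, porter seat `ymgap-nodeO-port-PTA-1` (gen 8); DEFINITION file, `--supports stmt-QuantumFields-27930`.  [I] = [Balaban1987RG1].
The cover bridge «torus power piece of `X` = integer power piece of `X̂_K(X)`» ((1.21) via (1.7)) matches a non-b₀ fluctuation index `(b, a)` with cube in `X` to the integer index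
`(b̂, a)`, `b̂` = THE lift of the level-`k` bond `b` whose source lies in the `L·Mc`-block of the CENTRED (`valMinAbs`) representative of the cube of `b₋` — the twin, one level down and
with block side `L·Mc`, of gen 6's lift of coarse bonds (✓`…JacOffWrap.exists_mem_coarseBondsOf_coverBondAt_eq`).
* `twinLiftSite F Mc k K x := (L·Mc)·valMinAbs(□(x)) + (x mod L·Mc)` coordinatewise (`□(x) = cubeOfSite (blockOf x)`), `twinLiftBond F Mc k K b := (twinLiftSite b₋, dir b)`.
Their properties (`⌊lift∕(L·Mc)⌋ = valMinAbs □`, `π_k ∘ lift = id`, membership in `twinBonds`, injectivity∕surjectivity off the wrap class) are the companion proof file `…LZdetTwinBridge`.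

HONEST FRAMING.  Definitions only; nothing of Bałaban asserted or proved; `stub_LZdetTwin` ∕ `stub_P0C` ∕ `stub_G3C` ∕ `stub_FE` OPEN; 27930 OPEN · no claim; NODE O 0∕1; COUNT 8∕28 · K 1∕4 UNMOVED; finite
`𝕋⁴_{L^K}` at fixed ε — NOT continuum ∕ OS ∕ Clay; **the Yang–Mills mass gap is NOT proved by any of this.**  No `sorry`, no `instance`, no `notation`; standard axioms.
-/

noncomputable section

namespace Summit.QuantumFields.YangMills.Theorems.BalabanUVNodesPortS1

open Summit.QuantumFields.YangMills.Theorems.K0RecordFormatNames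
open Literature.MathematicalPhysics.QuantumFieldTheory.Balaban1983to89
open Literature.MathematicalPhysics.QuantumFieldTheory.Balaban1983to89.Node00
open Literature.MathematicalPhysics.QuantumFieldTheory.Balaban1983to89.T4Continuum (T4Family)

/-- **The centred integer lift of a level-`k` torus site through its `Mc`-cube**: `(L·Mc)·valMinAbs(□(x))_i + (x_i mod L·Mc)` — the integer point of the `L·Mc`-block of the centred representative
of the cube of `x` with the remainders of `x`. [cite: Balaban1987RG1, (1.21) p.264, p.257 (bookkeeping)] -/
def twinLiftSite (F : T4Family) (Mc k K : ℕ) (x : Site (F.P K) k) : Fin 4 → ℤ :=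
  fun i => ((F.L * Mc : ℕ) : ℤ) * ((cubeOfSite F Mc k K (blockOf x) i).valMinAbs : ℤ) + (((x i).val % (F.L * Mc) : ℕ) : ℤ)

/-- **The centred integer lift of a level-`k` torus bond** (lift of the source, same direction). [cite: Balaban1987RG1, (1.21) p.264 (bookkeeping)] -/
def twinLiftBond (F : T4Family) (Mc k K : ℕ) (b : PBond (F.P K) k) : (Fin 4 → ℤ) × Fin 4 := (twinLiftSite F Mc k K b.src, b.dir)

end Summit.QuantumFields.YangMills.Theorems.BalabanUVNodesPortS1

end
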